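import Literature.NumberTheory.EllipticCurves.Castella2018.PAdicWaldspurgerFormula
import HarnessLib

/-!
# Castella, J. Inst. Math. Jussieu 17 (2018), Thms. 2.10–2.11 at weight two (with BDP 2013, Prop. 5.10
# and Castella 2018's printed dictionary): at a multiplicative prime `p ≥ 5` split in `K`, Castella's
# normalised BDP displays are CONTINUOUS AT THE TRIVIAL CHARACTER with limit
# `u · ((1 − a_p p⁻¹) · log_{ω_E} P_K)²`, `‖u‖ = 1` — for ANY conductor

Trunk `Literature/NumberTheory/EllipticCurves`; companion of `Castella2018/PAdicWaldspurgerFormula.lean`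
(`thm32_exists_isBDPLFunction_valueAtOne`: Cas18 Thms. 3.1–3.2 in the `∃`-FRAME currency
`L ∈ R₀⟦T⟧`, printed for SEMISTABLE `E`) and `BDPAnticyclotomicPAdicLFunction.lean`
(`bdpInterpolationValue`, `IsBDPLFunction`). ONE named fact (`def … : Prop`; nothing asserted) in the
FRAME-FREE currency «value continuity at `𝟙`» (no `R₀`, no Λ-adic element): the hypothesis `hC` of
`X11b.P2.bdpValueSomeFrameOnTree_of_hsieh2014_of_continuousDisplay` (cell b2b-bsdres, multr1-p2 gen 25,
"to be sourced: [cas-split] Thms. 2.10–2.11") and the `p ≥ 5` sister of cell bsd-stepL's (VC₃)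
(`Theses.ClassRecordThree.ValueContinuityAtThree`, p = 3, NOT in print). Cell `bsd-stepL`, seat
`bsd-stepL-bdp` g11 (memo PROOF-BDP §28). Consumer: `Summits/…/Theorems/ErratumRoadFiveValueByNormContinuity.lean`
((VC_p) ⟹ (VN_p) ⟹ the value conjunct of every ♭-frame, by one-sided norm rigidity).

## The printed statements (read first-hand on the held texts; chunk:line locators)

**[JIMJ18] = Castella, *On the exceptional specializations of big Heegner points*, J. Inst. Math.
Jussieu 17 (2018) 207–240 = arXiv:1507.04260** (`paper:arxiv-1507.04260`). Setting (p0003 L3–5,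
L36–38): «Fix a prime `p ≥ 5`, an integer `N > 0` prime to `p`, and let `f ∈ S₂(Γ₀(Np))` be a
newform. Throughout this paper, we shall assume that `f` is split multiplicative at `p` … `a_p(f) = 1`»;
«Let `K` be an imaginary quadratic field equipped with an integral ideal `𝔑 ⊂ 𝒪_K` with
`𝒪_K/𝔑 ≃ ℤ/Nℤ`, assume that `p` splits in `K`, and write `p𝒪_K = 𝔭𝔭̄` with `𝔭` the prime above `p`
induced by `ı_p`». §2.5 (p0011 L141): «let `c ≥ 1` be an integer prime to `Np`». §2.6 (p0013 L86–97):
«consider the set `Σ⁺_{k,c}` of algebraic Hecke characters … of conductor `c`, infinity type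
`(k+j, −j)` with `j ≥ 0` (with the convention in [bdp1]), and such that `χ|_{𝔸_ℚ^×} = N^k` … set
(def:Lp) `L_𝔭(f)(χ) := Σ_{[𝔞]∈Pic(𝒪_c)} χ⁻¹(𝔞)N(𝔞)^{−j} · d^j f^{[p]}(𝔞∗(A₀,t₀,ω_can))`, and define
`L_alg(f,χ⁻¹) := w(f,χ)⁻¹C(f,χ,c)·L(f,χ⁻¹,0)/Ω^{2(k+2j)}`, where `w(f,χ)` and `C(f,χ,c)` are the
constants defined in [bdp1] and [loc.cit., Thm. 4.6]». (p0013 L115–117): «As explained in [bdp1], the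
set `Σ⁺_{k,c}` may be endowed with a natural `p`-adic topology, and we let `Σ̂_{k,c}` denote its
completion.» **Theorem 2.10** (p0013 L119–131): «The assignment `χ ↦ L_𝔭(f)(χ)` extends to a
continuous function on `Σ̂_{k,c}` and satisfies the following interpolation property. If `χ ∈ Σ⁺_{k,c}`
has infinity type `(k+j, −j)`, with `j ≥ 0`, then `L_𝔭(f)(χ)²/Ω_p^{2(k+2j)} = (1 − a_p(f)χ⁻¹(𝔭̄))² ·
L_alg(f,χ⁻¹,0)`. Proof. See Theorem 5.9, Proposition 5.10, and equation (5.2.4) of [bdp1], noting that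
`β_p = 0` here, since `f` has level divisible by `p`.» (p0013 L134–139): «Let `Σ⁻_{k,c}` be the set of
algebraic Hecke characters of `K` of conductor `c` and infinity type `(k−1−j, 1+j)`, with `j ≥ 0` … any
character in `Σ⁻_{k,c}` can be written as a limit of characters in `Σ⁺_{k,c}` (see [bdp1]). Thus for
any `χ ∈ Σ⁻_{k,c}`, the value `L_𝔭(f)(χ)` is defined by continuity.» **Theorem 2.11** (p0014 L1–12):
«Let `f = q + Σ a_n(f)qⁿ ∈ S_k(Γ₀(Np))` be a `p`-new eigenform of weight `k = r+2 ≥ 2`, and suppose that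
`χ ∈ Σ⁻_{k,c}` has infinity type `(r+1−j, 1+j)`, with `0 ≤ j ≤ r`. Then `L_𝔭(f)(χ)/Ω_p^{r−2j} =
(1 − a_p(f)χ⁻¹(𝔭̄)) · ((c^{−j}/j!) Σ_{[𝔞]∈Pic(𝒪_c)} χ⁻¹(𝔞)N(𝔞) · AJ_F(Δ_{φ_𝔞φ₀})(ω_f ∧ ω_A^jη_A^{r−j}))`.»
(Prop. 2.7 ∕ Lemma 2.8, p0011–p0012: for `r = 0`, `AJ_F(Δ_φ)(ω_f) = F_{f,∞}(P_{A'})`, the Coleman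
primitive of `ω_f` vanishing at `∞`, i.e. `log_{ω_f}`.)

**[BDP13] = Bertolini–Darmon–Prasanna, Duke Math. J. 162 (2013)** (author version
`paper:url-39cfb2a03b1d`). §4.1 (p0381–p0385): «We assume henceforth that `K` satisfies the Heegner
hypothesis for `f` i.e., that all the primes `q ∣ N` are either split or ramified in `K`, and further
that if `q² ∣ N`, then `q` is split in `K`. This implies that there exists a cyclic `𝒪_K`-ideal `𝔑` of
norm `N` … fix an integer `c` prime to `N d_K`»; (p0395–p0397): «`Σ_cc(𝔑)` … the set of those characters
… of finite type `(c, 𝔑, ε_f)` and that satisfy the following auxiliary condition: the local sign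
`ε_q(f, χ⁻¹) = +1` for all finite primes `q`. In view of our other hypotheses, this condition is automatic
except possibly at those primes `q` lying in the set `S(f) := {q : q ∣ (N, d_K), q ∤ N_{ε_f}}`»; Thm. 4.6
(p0404–p0405): «Suppose also that `c` and `d_K` are odd». §5.2 (p0704): `Σ̂_cc(𝔑)` = the completion of
`Σ_cc^{(2)}(𝔑)` for «the topology of uniform convergence on `𝔸'_{K,f}`» (idèles PRIME TO `p`, values in
`𝒪_{F,𝔭_F}`); (5.2.4): `L_p(f,χ) = Ω_p^{2(k+2j)}(1 − χ⁻¹(𝔭̄)a_p + χ⁻²(𝔭̄)ε_f(p)p^{k−1})² L_alg(f,χ⁻¹,0)`;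
**Prop. 5.10** (p0712–p0713): «The function `χ ↦ L_p(f,χ)` extends to a continuous function on `Σ̂_cc(𝔑)`»
(proof: `χ₁ ≡ χ₂ (mod p^M)` on `𝔸'_{K,f}` ⇒ `L_p(f,χ₁) ≡ L_p(f,χ₂) (mod p^M)`).

**[Cas18] = Castella, Camb. J. Math. 6 (2018) = arXiv:1704.06608**, Thm. 3.1 (p0009; the tree's
display `bdpInterpolationValue p f 𝔭 φ n Ω_K · Ω_p^{4n}` with «`ε_p = 0` otherwise», i.e. at `p ∣ N`, IS
[JIMJ18]'s interpolation formula at `χ = N_K·φ`, `n = 1 + j`: `(1 − a_pχ⁻¹(𝔭̄)) = (1 − a_p p⁻¹ φ(𝔭))`,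
`Γ(j+1)Γ(k+j) = Γ(n)Γ(n+1)`, `2(k+2j) = 4n`) and the PROOF of Thm. 3.2 (p0009, verbatim in the companion
file): «This follows from … [cas-split] in the case `p ∣ N`. Indeed … (3.3) `L_p(f, 𝟙) = (1 − a_p p⁻¹ +
ε_p)² · (Σ_{σ∈Gal(H/K)} AJ_F(Δ^σ)(ω_f))²`. By [BK] … `AJ_F(Δ)(ω_f) = log_{ω_f}(Δ)`, and by (3.2) we have
the equalities up to a `p`-adic unit: `log_{ω_f}(Δ) = log_{π^*(ω_E)}(π(Δ)) = log_{ω_E}(π(Δ))`. Thus, taking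
`P_K := Σ_σ π(Δ^σ)`, the result follows.» — a paragraph that uses the parametrisation only through
(3.2) `π^*(ω_E) = c·ω_f`, `c ∈ ℤ_{(p)}^×`, and does NOT use the paper's standing semistability.

## What is typed, and why it follows (weight `k = 2`, `c = 1`, `ε_f = 1`, level `N = N_E = N₀p`)

(T1) CHARACTERS: a tree character `φ` (everywhere unramified, `HasInfinityType (n) (−n)`, `n ≥ 1`,
anticyclotomic — automatic) gives `χ := N_K·φ ∈ Σ⁺_{2,1}` (type `(2+j, −j)`, `j = n−1`; conductor `1`;
`χ|_{𝔸_ℚ^×} = N²`), and `N_K ∈ Σ⁻_{2,1}` (`j = 0`). (T2) SIGN: the auxiliary condition of `Σ_cc(𝔑)`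
can only fail at `q ∈ S(f) = {q ∣ (N, d_K)}`; for an everywhere-unramified anticyclotomic `φ` whose
avatar factors through the anticyclotomic `ℤ_p`-extension `Γ` one has `φ(𝔮) = 1` at a ramified
`𝔮² = (q)` (the class of `𝔮` is `2`-torsion in the anticyclotomic Galois group and `Γ ≅ ℤ_p` is
torsion-free), so `ε_q(f, χ⁻¹) = ε_q(f, N_K⁻¹)` is the SAME for every interpolation character and for the
limit `N_K`, and equals the local root number of `E/K` at `𝔮`, `= −a_q(E)·(…)`: it is `+1` iff `E` has
NON-SPLIT multiplicative reduction at `q` (Rohrlich's root numbers; with `d_K` odd this is also the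
condition `w(E/K) = −1` — cell memo PROOF-BDP §21 LEMMA C♯.1). The binder below asks exactly this:
every prime dividing both `N` and `d_K` is a prime of non-split multiplicative reduction (in particular
`q ∥ N`, so «`q² ∣ N ⇒ q` split» holds). (T3) TOPOLOGY: along an interpolation sequence with avatars
`r_k` through `Γ` and `r_k(γ) → 1`, `r_k → 𝟙` uniformly on `Γ`, hence `χ_k = N_K·φ_k → N_K` uniformly on
idèles prime to `p` (there `ι_p(φ_k(a)) = r_k(rec a)`), i.e. in `Σ̂`; so by Thm. 2.10 ∕ Prop. 5.10
`L_𝔭(f)(χ_k) → L_𝔭(f)(N_K)`, and by Thm. 2.11 (`r = j = 0`, `χ = N_K`: `χ⁻¹(𝔭̄) = p⁻¹`,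
`χ⁻¹(𝔞)N(𝔞) = 1`) `L_𝔭(f)(N_K) = (1 − a_p p⁻¹) · Σ_{[𝔞]} AJ_F(Δ_𝔞)(ω_f)`. (T4) DICTIONARY: by Thm. 2.10
and [Cas18] Thm. 3.1's display, `ι⁻¹(bdpInterpolationValue p f 𝔭 φ_k n_k Ω_K)·Ω_p^{4n_k} =
u_k · C · L_𝔭(f)(χ_k)²` with `C` a constant, `‖u_k‖ = 1`, `u_k` convergent (the `χ`-dependence of
`w(f,χ)` is through values of `φ_k` at fixed ideals, units tending to a limit; pure `n`-th powers —
`(−N)^{k/2+j}`, `b_N^{−k−2j}`, `vol(𝒪_c)^{−(k+2j)}`, the `π`-powers — are absorbed into the virtual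
periods `Ω_K ∈ ℂ^×`, `Ω_p ∈ ℂ_p^×`, which is why the periods are only asserted NON-ZERO here, not CM
periods in `R₀ˣ`); and by [Cas18]'s proof of Thm. 3.2, `C·(Σ_𝔞 AJ_F(Δ_𝔞)(ω_f))² = u'·(log_{ω_E} P_K)²`
up to a `p`-adic unit, `P_K = Σ_σ π(Δ^σ) =` the tree's `heegnerPointComplex Dt H` read in `E(K)`,
`log_{ω_E} = padicLogOmega W p e ·` along `e : K → ℚ_p` inducing `𝔭` (`c = Dt.c` a `p`-adic unit).
Hence the typed conclusion: the displays CONVERGE to `u·((1 − a_p p⁻¹)·log_{ω_E} P_K)²` with `‖u‖ = 1`.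

## Flags (nothing hidden)

* `JIMJ18-VC-dictionary-via-Cas18`: the unit bookkeeping (T4) is [Cas18] Thm. 3.1's display and the
  proof of Thm. 3.2, printed in a paper whose standing hypothesis is «`E` semistable»; the quoted
  paragraph does not use it, and [JIMJ18] ∕ [BDP13] allow any level prime to `p` ∕ any `N` with the
  Heegner hypothesis. Same status as the companion's flag `Cas18-Thm32-pN-via-cas-split`.
* `JIMJ18-split-mult-standing`: [JIMJ18] §1 fixes `a_p(f) = 1`; Thms. 2.10–2.11 are written with
  `a_p(f)` symbolic, Thm. 2.11 for «a `p`-new eigenform»; [Cas18] Thm. 3.2 (refereed) applies them for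
  both signs. The binder is `p` multiplicative (both signs), `5 ≤ p` as printed.
* `JIMJ18-sign-condition`: (T2) is a derivation (root numbers + class field theory), not a quoted
  sentence; the binder is the tree-expressible form of «`χ ∈ Σ_cc(𝔑)`» at `S(f)`.
* Weaker than print by design: `∃` virtual periods and a norm-one `u` (not Castella–Hsieh's CM periods,
  not `u ∈ R₀ˣ`), continuity only along interpolation sequences through `Γ` (not on all of `Σ̂`).

## References

* [Castella2018Exceptional] F. Castella, *On the exceptional specializations of big Heegner points*,
  J. Inst. Math. Jussieu 17 (2018) 207–240, §1 (p. 3), §2.5–2.6: Prop. 2.7, Lemma 2.8, (def:Lp),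
  Thm. 2.10, Thm. 2.11 (arXiv:1507.04260 pp. 11–14).
* [BertoliniDarmonPrasanna2013] M. Bertolini, H. Darmon, K. Prasanna, *Generalized Heegner cycles and
  p-adic Rankin L-series*, Duke Math. J. 162 (2013) 1033–1148, §4.1 (Heegner hypothesis, `Σ_cc(𝔑)`,
  `S(f)`), Thm. 4.6, §5.2 (5.2.4), Thm. 5.9, Prop. 5.10, Thm. 5.13. Journal pages (published PDF
  `paper:url-a1827f7d6bb2`, located by the cell's second reader imc-t1 g7, `HOME/imc-t1/VNp-PRINT-STATUS.md`
  v3 §8): Assumption 1.9 p. 1053; §4.1 with Def. 4.4 and `S(f)` pp. 1093–1094; Thm. 4.6 and Rem. 4.7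
  («for convenience», the parity of `d_K`) p. 1095; Assumption 5.12 and Thm. 5.13 p. 1137. The binder
  `NumberField.discr K < -3` below is inherited from [Cas20, §2.5] and is NOT required by [BDP13] ∕
  [JIMJ18] ∕ [Cas18] (both keep `w_K = #𝒪_K^×` ∕ `u = #𝒪_K^×/2` general): the fact is stated weaker than
  print at `K = ℚ(√−3)`; immaterial at erratum data (`IsErratumField.discr_lt_neg_three`).
* [Castella2018] F. Castella, Camb. J. Math. 6 (2018), Thm. 3.1 (display), Thm. 3.2 and its proof
  ((3.2), (3.3), [BK]) (arXiv:1704.06608 p. 9).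
* [Rohrlich1993] D. Rohrlich, *Variation of the root number in families of elliptic curves*,
  Compositio Math. 87 (1993), Prop. 2–3 (local root numbers at multiplicative and additive potentially
  multiplicative primes).
-/

noncomputable section

open scoped Classical Topology
open Filter NumberField IsDedekindDomain Field
open Literature.NumberTheory.GaloisRepresentations
open Literature.NumberTheory.EllipticCurves.ModularForms

namespace Literature.NumberTheory.EllipticCurves

/-- **Castella 2018 (J. Inst. Math. Jussieu 17), Thms. 2.10–2.11 at weight two, with BDP 2013 Prop. 5.10
and Castella 2018 (Camb. J. Math. 6) Thm. 3.1's display ∕ proof of Thm. 3.2: VALUE CONTINUITY AT `𝟙`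
of the normalised BDP displays at a MULTIPLICATIVE `p ≥ 5`, any conductor** — named fact. For: `W/ℚ`
globally minimal of conductor `N`, `Dt` a modular parametrisation datum at level `N` (its newform
`Dt.f`) with `p ∤ c` (Cas18 (3.2)); `p ≥ 5` of multiplicative reduction ([JIMJ18]: `f ∈ S₂(Γ₀(N₀p))`,
`p ∤ N₀`); `K` imaginary quadratic with `d_K` odd and `< −3`, `p = 𝔭𝔭̄` split, `𝔭 ∋ p` compatible with
the embedding datum `ι : ℚ̄_p ≃ ℂ` (as in A206); BDP13's Heegner hypothesis (every `ℓ ∣ N` has a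
degree-one prime of `K`) and the tree form of BDP13's auxiliary sign condition at `S(f)` (every prime
dividing both `N` and `d_K` is a prime of NON-split multiplicative reduction — module docstring (T2));
a Heegner datum `H`, the Heegner point `P ∈ E(K)` (`P.map w.embedding = heegnerPointComplex Dt H`),
an embedding `e : K → ℚ_p` inducing `𝔭`; `κ` anticyclotomic with topological generator `γ`. Conclusion:
THERE ARE `Ω_K ∈ ℂ^×`, `Ω_p ∈ ℂ_p^×` and `u ∈ ℂ_p` with `‖u‖ = 1` such that along EVERY sequence of
everywhere-unramified Hecke characters `φ_k` of infinity type `(n_k, −n_k)`, `n_k > 0`, with `p`-adic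
avatars `r_k` factoring through `κ` and `r_k(γ) → 1`, the displays
`ι⁻¹(bdpInterpolationValue p f 𝔭 φ_k n_k Ω_K)·Ω_p^{4n_k}` tend to `u·((1 − a_p(E)p⁻¹)·log_{ω_E} P)²`
(`log_{ω_E} P = padicLogOmega W p e P`). See the module docstring for the derivation (T1)–(T4) from the
quoted statements and for the flags. PUBLISHED sources only; nothing below `p = 5`.
[cite: Castella2018Exceptional, Thm. 2.10 and Thm. 2.11 with Prop. 2.7 / Lemma 2.8 (arXiv:1507.04260 pp. 11–14)]
[cite: BertoliniDarmonPrasanna2013, §4.1 (Heegner hypothesis, Σ_cc(𝔑), S(f)), (5.2.4), Prop. 5.10, Thm. 5.13]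
[cite: Castella2018, Thm. 3.1 (display) and proof of Thm. 3.2 ((3.2), (3.3), [BK]) (arXiv:1704.06608 p. 9)] -/
def castella2018Exceptional_bdpValueContinuity_trivialChar : Prop :=
  ∀ {p : ℕ} [Fact p.Prime] (ι : PadicAlgCl p ≃+* ℂ) (W : WeierstrassCurve ℚ) [W.IsElliptic]
    [W.IsGloballyMinimal] (K : Type) [Field K] [NumberField K] (𝔭 : HeightOneSpectrum (𝓞 K))
    (κ : ZpExtension K p) (γ : absoluteGaloisGroup K) {N : ℕ} [NeZero N]
    (Dt : ModularParametrizationData W N) (H : HeegnerDatum N (NumberField.discr K))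
    (w : InfinitePlace K) (e : K →+* ℚ_[p]) (P : (W.baseChange K).toAffine.Point),
    5 ≤ p → W.conductorNorm ℤ = N → W.HasMultiplicativeReductionAtPrime p →
    IsImaginaryQuadratic K → Odd (NumberField.discr K) → NumberField.discr K < -3 →
    ((Ideal.span {(p : ℤ)}).primesOver (𝓞 K)).ncard = 2 →
    ((p : ℕ) : 𝓞 K) ∈ 𝔭.asIdeal →
    (∀ (w' : InfinitePlace K) (k : 𝓞 K),
      k ∈ 𝔭.asIdeal ↔ ‖ι.symm (w'.embedding (k : K))‖ < 1) →
    (∀ ℓ : ℕ, ℓ.Prime → ℓ ∣ N → ∃ v : HeightOneSpectrum (𝓞 K), Ideal.absNorm v.asIdeal = ℓ) →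
    (∀ (ℓ : ℕ) [Fact ℓ.Prime], ℓ ∣ N → (ℓ : ℤ) ∣ NumberField.discr K →
      W.HasMultiplicativeReductionAtPrime ℓ ∧ ¬ W.HasSplitMultiplicativeReductionAtPrime ℓ) →
    κ.IsAnticyclotomic → κ.IsTopGenerator γ →
    ¬ (p : ℤ) ∣ Dt.c →
    WeierstrassCurve.Affine.Point.map w.embedding.toRatAlgHom P = heegnerPointComplex Dt H →
    (∀ k : 𝓞 K, k ∈ 𝔭.asIdeal ↔ ‖e (k : K)‖ < 1) →
    ∃ (ΩK : ℂ) (Ωp : ℂ_[p]) (u : ℂ_[p]), ΩK ≠ 0 ∧ Ωp ≠ 0 ∧ ‖u‖ = 1 ∧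
      ∀ (φ : ℕ → HeckeCharacter K) (n : ℕ → ℕ) (r : ℕ → FramedGaloisRep K (PadicAlgCl p) 1),
        (∀ k, 0 < n k) → (∀ k (v : HeightOneSpectrum (𝓞 K)), (φ k).IsUnramifiedAt v) →
        (∀ k, (φ k).HasInfinityType (fun _ ↦ (n k : ℤ)) (fun _ ↦ -(n k : ℤ))) →
        (∀ k, IsPAdicAvatarOf ι (φ k) (r k)) → (∀ k, FactorsThroughZp κ (r k)) →
        Tendsto (fun k ↦ avatarValueAt (r k) γ) atTop (𝓝 1) →
        Tendsto (fun k ↦ ((ι.symm (bdpInterpolationValue p Dt.f 𝔭 (φ k) (n k) ΩK) : PadicAlgCl p) :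
            ℂ_[p]) * Ωp ^ (4 * n k)) atTop
          (𝓝 (u * (algebraMap ℚ_[p] ℂ_[p] (((1 : ℚ_[p]) - (W.LFunction p : ℚ_[p]) * (p : ℚ_[p])⁻¹) *
            Castella2018.padicLogOmega W p e P)) ^ 2))

/-! ### API (proved): the NORM form -/

/-- **Norm continuity at `𝟙` from value continuity** (take norms; `‖u‖ = 1`): under the fact, the
NORMS of the displays tend to `‖(1 − a_p p⁻¹)·log_{ω_E} P‖²` — the form consumed by one-sided norm
rigidity on the Summits side. [cite: Castella2018Exceptional, Thms. 2.10–2.11 (arXiv:1507.04260 pp. 13–14)] -/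
theorem tendsto_norm_bdpInterpolationValue_of_valueContinuity
    (h : castella2018Exceptional_bdpValueContinuity_trivialChar)
    {p : ℕ} [Fact p.Prime] (ι : PadicAlgCl p ≃+* ℂ) (W : WeierstrassCurve ℚ) [W.IsElliptic]
    [W.IsGloballyMinimal] (K : Type) [Field K] [NumberField K] (𝔭 : HeightOneSpectrum (𝓞 K))
    (κ : ZpExtension K p) (γ : absoluteGaloisGroup K) {N : ℕ} [NeZero N]
    (Dt : ModularParametrizationData W N) (H : HeegnerDatum N (NumberField.discr K))
    (w : InfinitePlace K) (e : K →+* ℚ_[p]) (P : (W.baseChange K).toAffine.Point)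
    (h5 : 5 ≤ p) (hN : W.conductorNorm ℤ = N) (hmult : W.HasMultiplicativeReductionAtPrime p)
    (hK : IsImaginaryQuadratic K) (hodd : Odd (NumberField.discr K)) (h3 : NumberField.discr K < -3)
    (hsplit : ((Ideal.span {(p : ℤ)}).primesOver (𝓞 K)).ncard = 2)
    (h𝔭 : ((p : ℕ) : 𝓞 K) ∈ 𝔭.asIdeal)
    (hcompat : ∀ (w' : InfinitePlace K) (k : 𝓞 K),
      k ∈ 𝔭.asIdeal ↔ ‖ι.symm (w'.embedding (k : K))‖ < 1)
    (hHeeg : ∀ ℓ : ℕ, ℓ.Prime → ℓ ∣ N → ∃ v : HeightOneSpectrum (𝓞 K), Ideal.absNorm v.asIdeal = ℓ)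
    (hsign : ∀ (ℓ : ℕ) [Fact ℓ.Prime], ℓ ∣ N → (ℓ : ℤ) ∣ NumberField.discr K →
      W.HasMultiplicativeReductionAtPrime ℓ ∧ ¬ W.HasSplitMultiplicativeReductionAtPrime ℓ)
    (hκ : κ.IsAnticyclotomic) (hγ : κ.IsTopGenerator γ) (hc : ¬ (p : ℤ) ∣ Dt.c)
    (hP : WeierstrassCurve.Affine.Point.map w.embedding.toRatAlgHom P = heegnerPointComplex Dt H)
    (he : ∀ k : 𝓞 K, k ∈ 𝔭.asIdeal ↔ ‖e (k : K)‖ < 1) :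
    ∃ (ΩK : ℂ) (Ωp : ℂ_[p]), ΩK ≠ 0 ∧ Ωp ≠ 0 ∧
      ∀ (φ : ℕ → HeckeCharacter K) (n : ℕ → ℕ) (r : ℕ → FramedGaloisRep K (PadicAlgCl p) 1),
        (∀ k, 0 < n k) → (∀ k (v : HeightOneSpectrum (𝓞 K)), (φ k).IsUnramifiedAt v) →
        (∀ k, (φ k).HasInfinityType (fun _ ↦ (n k : ℤ)) (fun _ ↦ -(n k : ℤ))) →
        (∀ k, IsPAdicAvatarOf ι (φ k) (r k)) → (∀ k, FactorsThroughZp κ (r k)) →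
        Tendsto (fun k ↦ avatarValueAt (r k) γ) atTop (𝓝 1) →
        Tendsto (fun k ↦ ‖((ι.symm (bdpInterpolationValue p Dt.f 𝔭 (φ k) (n k) ΩK) : PadicAlgCl p) :
            ℂ_[p]) * Ωp ^ (4 * n k)‖) atTop
          (𝓝 (‖algebraMap ℚ_[p] ℂ_[p] (((1 : ℚ_[p]) - (W.LFunction p : ℚ_[p]) * (p : ℚ_[p])⁻¹) *
            Castella2018.padicLogOmega W p e P)‖ ^ 2)) := by
  obtain ⟨ΩK, Ωp, u, hΩK, hΩp, hu, hcont⟩ :=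
    h ι W K 𝔭 κ γ Dt H w e P h5 hN hmult hK hodd h3 hsplit h𝔭 hcompat hHeeg hsign hκ hγ hc hP he
  refine ⟨ΩK, Ωp, hΩK, hΩp, fun φ n r hn hunr hinf hr hrκ hlim ↦ ?_⟩
  have h' := (hcont φ n r hn hunr hinf hr hrκ hlim).norm
  rwa [norm_mul, hu, one_mul, norm_pow] at h'

end Literature.NumberTheory.EllipticCurves

end
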